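import Summits.ResolutionOfSingularities.ResolutionOfSingularities.Theorems.FrobeniusLadderFRationalResolutionFixedChartOfRoot
import Summits.ResolutionOfSingularities.ResolutionOfSingularities.Theorems.FrobeniusLadderFRationalResolutionHypersurfaceLocalRegular
import Mathlib.Algebra.Polynomial.Derivation
import HarnessLib

/-!
# Crux `FrobeniusLadder.FRationalResolution` (stmt-ResolutionOfSingularities-15317), line `redirect`,
# stub `stub_diagonalizableQuotientResolution` — item (F2), root-adjunction step (R) for a TAME exponent: `S̃ = S[w]/(w^d − u)` is
# regular at the primes over the point when `d` is invertible there (certificate `d/dX`), and the corresponding fixed re-charting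

The derivation certificate of `…RootAdjoinRegularOfDerivation` in its general form: for ANY derivation `D` of a ring `R` and a
prime `P`, `f ∈ P` with `D f ∉ P` forces `f ∉ (P R_P)²`. With `D = d/dX` on `S[X]`: `D (X^d − C u) = d X^{d−1}` is outside `𝔓'`
as soon as `d ∉ 𝔓'` and `u ∉ 𝔓'` (`X^d ≡ u`), so:

* `not_mem_sq_of_derivation_not_mem` — the general certificate;
* `not_mem_sq_of_natCast_not_mem`, `isRegularLocalRing_localization_adjoinRoot_of_natCast_not_mem` — the tame-exponent case;
* `mem_iff_mem_of_comap_eq` — homogeneous elements lie in a prime of an `A`-graded ring (torsion `A`) iff they lie in any other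
  prime over the same point of `Spec S₀` (a power is of degree zero);
* `isRegularLocalRing_localization_adjoinRoot_of_isUnit_natCast` — graded form: `u ∈ S_b ∖ 𝔔`, `d` a unit of `k` ⇒ `hreg`;
* ★★ `exists_fixed_chart_of_isUnit_natCast` — item (F2) (R)+(S) in the stub's frame for `d ∈ k^×`: `B ⊔ ⟨a⟩ = ⊤`, `d • a = deg u`,
  `u ∉ 𝔔`, `j • a ∉ B (0 < j < d)` ⇒ `φ v` is the image of a FIXED point of a chart of the same shape.

Together with `…FixedChartOfWildDegree` (`deg u ∉ p·B`) this makes the hypothesis `hreg` of `…FixedChartOfRoot` available for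
every root the multi-root recipe of MEMO-15317-leafhand2-g22 needs (`p`-power-order basis degrees: wild file; prime-to-`p`
orders with a prime-to-`p` exponent: this file). Honest label: helper toward ONE leaf stub; no stub, crux or summit closed.
No definitions, no named facts, no sorry. [cite: Matsumura1987, Thm. 14.2; §25] [folklore; cite: SGA3, Exp. VIII §4–5]
-/

noncomputable section

-- single-problem summit: the doubled namespace component is forced
set_option linter.dupNamespace false

open CategoryTheory AlgebraicGeometry IsLocalRing Polynomial
open Literature.AlgebraicGeometry.Resolution

namespace Summit.ResolutionOfSingularities.ResolutionOfSingularities.Theorems.FRationalResolution.RootAdjoinRegularOfTameDegree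

universe u v w

/-! ### The general derivation certificate -/

/-- **Derivation certificate, general form.** `D` a derivation of `R`, `P` a prime, `f ∈ P` with `D f ∉ P`: the image of `f` in
`R_P` is not in the square of the maximal ideal (`D` maps `P²` into `P`). [cite: Matsumura1987, §25] -/
theorem not_mem_sq_of_derivation_not_mem {R₀ : Type v} [CommSemiring R₀] {R : Type u} [CommRing R] [Algebra R₀ R]
    (D : Derivation R₀ R R) (P : Ideal R) [hP : P.IsPrime]
    {f : R} (hf : f ∈ P) (hDf : D f ∉ P) :
    algebraMap R (Localization.AtPrime P) f ∉ maximalIdeal (Localization.AtPrime P) ^ 2 := by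
  -- `D` maps `P²` into `P`
  have hDsq : ∀ g ∈ P ^ 2, D g ∈ P := by
    intro g hg
    rw [pow_two] at hg
    refine Submodule.mul_induction_on hg (fun a ha b hb => ?_) (fun x y hx hy => ?_)
    · rw [Derivation.leibniz, smul_eq_mul, smul_eq_mul]
      exact P.add_mem (P.mul_mem_right (D b) ha) (P.mul_mem_right (D a) hb)
    · rw [map_add]; exact P.add_mem hx hy
  intro hmem
  rw [← Localization.AtPrime.map_eq_maximalIdeal, ← Ideal.map_pow, IsLocalization.mem_map_algebraMap_iff P.primeCompl] at hmem
  obtain ⟨⟨⟨g, hg⟩, ⟨m, hm⟩⟩, hgm⟩ := hmem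
  obtain ⟨⟨c, hc⟩, hcfm⟩ := (IsLocalization.eq_iff_exists P.primeCompl _).1
    (show algebraMap R (Localization.AtPrime P) (f * m) = algebraMap R _ g by rw [map_mul]; exact hgm)
  simp only at hcfm
  have hs : c * m ∉ P := fun h => (hP.mem_or_mem h).elim hc hm
  have hsf : c * m * f ∈ P ^ 2 := by
    rw [mul_assoc, mul_comm m f, hcfm]
    exact Ideal.mul_mem_left _ _ hg
  have h1 : D (c * m * f) ∈ P := hDsq _ hsf
  rw [Derivation.leibniz, smul_eq_mul, smul_eq_mul] at h1
  have h2 : c * m * D f ∈ P := by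
    have h3 : f * D (c * m) ∈ P := P.mul_mem_right _ hf
    have := P.sub_mem h1 h3
    rwa [add_sub_cancel_right] at this
  exact hDf ((hP.mem_or_mem h2).resolve_left hs)

/-! ### Tame exponent: the certificate `d/dX` -/

/-- **Tame-exponent certificate.** `𝔓'` a prime of `S[X]` containing `X^d − C u` with `d ∉ 𝔓'` and `u ∉ 𝔓'` (constants): the image
of `X^d − C u` in `S[X]_{𝔓'}` is not in the square of the maximal ideal (`d/dX (X^d − u) = d X^{d−1} ∉ 𝔓'`).
[cite: Matsumura1987, §25] -/
theorem not_mem_sq_of_natCast_not_mem {S : Type u} [CommRing S] (u : S) (d : ℕ) (𝔓' : Ideal S[X]) [h𝔓' : 𝔓'.IsPrime]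
    (hf : (X ^ d - C u : S[X]) ∈ 𝔓') (hd : C (d : S) ∉ 𝔓') (hu : C u ∉ 𝔓') :
    algebraMap S[X] (Localization.AtPrime 𝔓') (X ^ d - C u) ∉ maximalIdeal (Localization.AtPrime 𝔓') ^ 2 := by
  refine not_mem_sq_of_derivation_not_mem (derivative' : Derivation S S[X] S[X]) 𝔓' hf ?_
  rw [derivative'_apply, derivative_sub, derivative_X_pow, derivative_C, sub_zero]
  intro h
  rcases h𝔓'.mem_or_mem h with h | h
  · exact hd h
  · have hX : (X : S[X]) ∈ 𝔓' := h𝔓'.mem_of_pow_mem _ h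
    have hXd : (X : S[X]) ^ d ∈ 𝔓' := by
      rcases Nat.eq_zero_or_pos d with hd0 | hd0
      · exfalso; apply hd; rw [hd0, Nat.cast_zero, map_zero]; exact 𝔓'.zero_mem
      · exact 𝔓'.pow_mem_of_mem hX d hd0
    apply hu
    have := 𝔓'.sub_mem hXd hf
    rwa [sub_sub_cancel] at this

/-- **Regularity of `(AdjoinRoot (X^d − C u))_𝔓` for a tame exponent.** `S` regular, `d` and `u` outside `𝔓 ∩ S`.
[cite: Matsumura1987, Thm. 14.2; §25] -/
theorem isRegularLocalRing_localization_adjoinRoot_of_natCast_not_mem {S : Type u} [CommRing S] [IsRegularRing S] (u : S)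
    (d : ℕ) (𝔓 : Ideal (AdjoinRoot (X ^ d - C u : S[X]))) [𝔓.IsPrime]
    (hd : (d : S) ∉ 𝔓.comap (AdjoinRoot.of (X ^ d - C u : S[X]))) (hu : u ∉ 𝔓.comap (AdjoinRoot.of (X ^ d - C u : S[X]))) :
    IsRegularLocalRing (Localization.AtPrime 𝔓) := by
  haveI : (𝔓.comap (AdjoinRoot.mk (X ^ d - C u : S[X]))).IsPrime := Ideal.IsPrime.comap _
  have hof : 𝔓.comap (AdjoinRoot.of (X ^ d - C u : S[X])) = (𝔓.comap (AdjoinRoot.mk (X ^ d - C u : S[X]))).comap C := by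
    rw [Ideal.comap_comap]; rfl
  rw [hof, Ideal.mem_comap] at hd hu
  refine HypersurfaceLocalRegular.isRegularLocalRing_localization_adjoinRoot_of_not_mem_sq _ 𝔓
    (not_mem_sq_of_natCast_not_mem u d _ ?_ hd hu)
  rw [Ideal.mem_comap, AdjoinRoot.mk_self]; exact 𝔓.zero_mem

/-! ### Graded form -/

/-- **Homogeneous elements do not distinguish primes over the same point of `Spec S₀`.** `S` graded by a torsion group `A`, `𝔔`,
`𝔔₁` primes of `S` with the same contraction to `S₀`, `s ∈ S_i`: `s ∈ 𝔔 ↔ s ∈ 𝔔₁` (the power `s^{ord i}` is of degree zero).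
[folklore; cite: SGA3, Exp. VIII §4–5] -/
theorem mem_iff_mem_of_comap_eq {k : Type u} [CommRing k] {A : Type w} [DecidableEq A] [AddCommGroup A] {S : Type v}
    [CommRing S] [Algebra k S] (𝒮 : A → Submodule k S) [GradedAlgebra 𝒮] (hA : AddMonoid.IsTorsion A)
    (𝔔 𝔔₁ : Ideal S) [𝔔.IsPrime] [𝔔₁.IsPrime] (h : 𝔔₁.comap (algebraMap (𝒮 0) S) = 𝔔.comap (algebraMap (𝒮 0) S))
    {i : A} {s : S} (hs : s ∈ 𝒮 i) : s ∈ 𝔔 ↔ s ∈ 𝔔₁ := by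
  have hpow : s ^ addOrderOf i ∈ 𝒮 0 := DiagonalizableQuotient.pow_addOrderOf_mem_gradeZero 𝒮 hs
  have hn : 0 < addOrderOf i := (hA i).addOrderOf_pos
  constructor
  · intro hm
    have h1 : (⟨s ^ addOrderOf i, hpow⟩ : 𝒮 0) ∈ 𝔔₁.comap (algebraMap (𝒮 0) S) := by
      rw [h, Ideal.mem_comap]; exact 𝔔.pow_mem_of_mem hm _ hn
    exact (inferInstance : 𝔔₁.IsPrime).mem_of_pow_mem _ (Ideal.mem_comap.1 h1)
  · intro hm
    have h1 : (⟨s ^ addOrderOf i, hpow⟩ : 𝒮 0) ∈ 𝔔.comap (algebraMap (𝒮 0) S) := by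
      rw [← h, Ideal.mem_comap]; exact 𝔔₁.pow_mem_of_mem hm _ hn
    exact (inferInstance : 𝔔.IsPrime).mem_of_pow_mem _ (Ideal.mem_comap.1 h1)

/-- **`hreg` for a tame exponent.** `S` regular graded by the torsion group `A` over `k`, `u ∈ S_b ∖ 𝔔`, `d` a unit in `k`:
`AdjoinRoot (X^d − C u)` is a regular local ring at every prime over the point `𝔔 ∩ S₀` (the polynomial is separable there).
[folklore; cite: SGA1, Exp. I Prop. 7.6] [cite: Matsumura1987, Thm. 14.2; §25] -/
theorem isRegularLocalRing_localization_adjoinRoot_of_isUnit_natCast {k : Type u} [CommRing k] {A : Type w} [DecidableEq A]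
    [AddCommGroup A] {S : Type u} [CommRing S] [Algebra k S] (𝒮 : A → Submodule k S) [GradedAlgebra 𝒮] [IsRegularRing S]
    (hA : AddMonoid.IsTorsion A) (𝔔 : Ideal S) [𝔔.IsPrime] {b : A} {u : S} (hu : u ∈ 𝒮 b) (huQ : u ∉ 𝔔) (d : ℕ)
    (hd : IsUnit (d : k)) (𝔓 : Ideal (AdjoinRoot (X ^ d - C u : S[X]))) [𝔓.IsPrime]
    (h𝔓 : 𝔓.comap (algebraMap (𝒮 0) (AdjoinRoot (X ^ d - C u : S[X]))) = 𝔔.comap (algebraMap (𝒮 0) S)) :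
    IsRegularLocalRing (Localization.AtPrime 𝔓) := by
  set 𝔔₁ : Ideal S := 𝔓.comap (AdjoinRoot.of (X ^ d - C u : S[X])) with h𝔔₁
  haveI : 𝔔₁.IsPrime := Ideal.IsPrime.comap _
  have h𝔔₁0 : 𝔔₁.comap (algebraMap (𝒮 0) S) = 𝔔.comap (algebraMap (𝒮 0) S) := by
    rw [← h𝔓, h𝔔₁, Ideal.comap_comap]; rfl
  refine isRegularLocalRing_localization_adjoinRoot_of_natCast_not_mem u d 𝔓 ?_ ?_
  · intro h
    have h1 : IsUnit ((d : S)) := by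
      have := hd.map (algebraMap k S)
      rwa [map_natCast] at this
    exact (inferInstance : 𝔔₁.IsPrime).ne_top (Ideal.eq_top_of_isUnit_mem _ h h1)
  · exact fun h => huQ ((mem_iff_mem_of_comap_eq 𝒮 hA 𝔔 𝔔₁ h𝔔₁0 hu).2 h)

/-! ### The assembled re-charting for a tame exponent -/

/-- ★★ **Item (F2), tame exponent, unconditionally.** Chart `(A, S, 𝒮, φ)` of the stub's shape with `S` regular, point `v`,
prime `𝔔` over `v` with unit-degree subgroup `B`, a homogeneous `u ∈ S_b ∖ 𝔔`, `d • a = b` with `d ≥ 2` a unit in `k`,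
`B ⊔ ⟨a⟩ = ⊤`, `j • a ∉ B` for `0 < j < d`: `φ v` is the image of a FIXED point of a quotient chart of the same shape with the same
invariants. [folklore; cite: SGA1, Exp. I Prop. 7.6; SGA3, Exp. VIII §4–5] [cite: Matsumura1987, Thm. 14.2; §30, Cor. to Thm. 30.5] -/
theorem exists_fixed_chart_of_isUnit_natCast (k : Type) [Field k] (X : Scheme.{0}) (g : X ⟶ Spec (.of k))
    (A : Type) [AddCommGroup A] [Finite A] [DecidableEq A] (S : Type) [CommRing S] [Algebra k S]
    (𝒮 : A → Submodule k S) [GradedAlgebra 𝒮] [Algebra.FiniteType k S] [IsRegularRing S]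
    (φ : Spec (.of (𝒮 0)) ⟶ X) [Etale φ]
    (hφg : φ ≫ g = Spec.map (CommRingCat.ofHom (algebraMap k (𝒮 0))))
    (v : Spec (.of (𝒮 0))) (𝔔 : Ideal S) [𝔔.IsPrime] (h𝔔v : 𝔔.comap (algebraMap (𝒮 0) S) = v.asIdeal)
    (B : AddSubgroup A) (hB : ∀ i : A, i ∈ B ↔ ∃ s ∈ 𝒮 i, s ∉ 𝔔)
    (u : S) (b : A) (hu : u ∈ 𝒮 b) (huQ : u ∉ 𝔔) (a : A) (d : ℕ) (hd : 1 < d) (hab : d • a = b)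
    (hgen : B ⊔ AddSubgroup.zmultiples a = ⊤) (hmin : ∀ j : ℕ, 0 < j → j < d → j • a ∉ B)
    (hdk : (d : k) ≠ 0) :
    ∃ (A' : Type) (_ : AddCommGroup A') (_ : Finite A') (_ : DecidableEq A')
      (S' : Type) (_ : CommRing S') (_ : Algebra k S') (𝒮' : A' → Submodule k S')
      (_ : GradedAlgebra 𝒮'),
      Algebra.FiniteType k S' ∧ IsRegularRing S' ∧
      ∃ (φ' : Spec (.of (𝒮' 0)) ⟶ X), Etale φ' ∧
        φ' ≫ g = Spec.map (CommRingCat.ofHom (algebraMap k (𝒮' 0))) ∧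
        ∃ (v' : Spec (.of (𝒮' 0))) (𝔔' : Ideal S') (_ : 𝔔'.IsPrime),
          𝔔'.comap (algebraMap (𝒮' 0) S') = v'.asIdeal ∧
          (∀ c : A', c ≠ 0 → ∀ s ∈ 𝒮' c, s ∈ 𝔔') ∧ φ' v' = φ v := by
  have hA : AddMonoid.IsTorsion A := fun i => isOfFinAddOrder_of_finite i
  exact FixedChartOfRoot.exists_fixed_chart_of_rootAdjoin k X g A S 𝒮 φ hφg v 𝔔 h𝔔v B hB u b hu huQ a d hd hab hgen hmin
    fun 𝔓 _ h𝔓 => isRegularLocalRing_localization_adjoinRoot_of_isUnit_natCast 𝒮 hA 𝔔 hu huQ d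
      (isUnit_iff_ne_zero.2 hdk) 𝔓 (h𝔓.trans h𝔔v.symm)

end Summit.ResolutionOfSingularities.ResolutionOfSingularities.Theorems.FRationalResolution.RootAdjoinRegularOfTameDegree

end
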